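import Literature.NumberTheory.Rogawski1990.XiLocalCharacter                            -- ★ `OneDimAutRepH.xiLocalChar`, `localDet`, `torusLocalComponent`; brings `torusCharPair`, `quotConj`, `halfModulusChar`, `cmLocalForm`
import Summits.HodgeConjecture.HodgeConjecture.Theorems.K2E1GroundFieldChangeLocalIso    -- ★ `exists_cmDatum_local_equiv` (the currency's `e₃ e₂ e₁`)
import HarnessLib

/-!
# R90-TF · S10 (Rogawski 1990 §13.8) · THEOREMS — `R90S10LocalCarrierTransport`: the (U2) CARRIERS transport along S3's local datum `(Φ, hc, hc′, hΦσ)`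

Cell hodgecm-mathlib, slab R90-TF, section S10 = §13.8, crux item h413 = stmt-HodgeConjecture-24833 (route `route-HodgeConjecture-HCCMUnconditional`);
seat R90-C138-p05 (g0), card «(U2) carriers for `sock_S10_localTransportStBeta`» of DEAL-S10-WAVE1 (R90-C138-plan (g2), 2026-09-04T23:13Z); consumer = the
(U2) head `Theorems/R90S10StSpectralHypAtTransport.lean` (R90-C138-p06) and S3's wave-4 bricks G1–G7 (`Cruxes/H413/Lines/R90_S3_LocalTransportWaveG.lean`).
Lane `--supports stmt-HodgeConjecture-24833 --as helper`; THEOREMS ONLY (no definition, no instance, no notation, no `sorry`); ★-only imports (a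
`Theorems/` file never imports `Cruxes/…/Lines`, LAW L9); namespace `…R90.S10`.

WHAT.  The organ letter (S-β) ★ `StSpectralHypAt L μ ξ v` (`Theorems/K2E1StSpectralHypAtOfSt1383At.lean` :99) names, besides the groups `H_v`, `G_v` and the
measure ∕ packet vocabulary that S3 transports (G1–G7), five CARRIERS built from `ξ = (η, ψ)` and the local ring `R_v = L ⊗ L⁺_v`:
`halfModulusChar R_v = ‖·‖_v^{1/2}`, `quotConj (c ⊗ 1) = (a ↦ a/ā)`, `localDet = det : U(Φ_N)(L⁺_v) → E¹_v`, the label character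
`torusCharPair … 0 ((η_v ∘ quotConj) · ‖·‖^{1/2}) ψ_v` of the diagonal torus of `U(Φ₂)(L⁺_v)` with `ψ_v ∘ det` on `U(Φ₁)(L⁺_v)` (the `χ₂ ⊠ χ₁` of ★
`HLengthTwoLabels`), and the local character `ξ_v = ξ.xiLocalChar v` of `H_v` (the `charDist` slot).  Along S3's UNBUNDLED local-transport datum
`Φ : R_v ≃+* R′_{v′}` (bicontinuous `hc hc′`, intertwining the conjugations `hΦσ`; ★ K2E1 row 21) with the induced group isomorphisms `(e₂, he₂), (e₁, he₁),
(e_H, heH)` acting ENTRYWISE by `Φ` (S3's binder bytes, ★ `Theorems/R90S3TransportDeltaTransfer.lean` :98–:156), and the two torus-character binders `hΦη hΦψ` of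
the (U2) letter `LocalTransportStBetaLetter` (`R90S10LocalGlobaliseUDefs` :61–:68: «`η′_{v′} ∘ Φ = η_v`, `ψ′_{v′} ∘ Φ = ψ_v` on `T(L⁺_v) = normOneUnits (c ⊗ 1)`»), EVERY
carrier at `(L′, v′, ξ′)` read through `Φ` equals the carrier at `(L, v, ξ)`:
* §1 (generic rings `Φ : R ≃+* R′`, `Φ ∘ σ = σ′ ∘ Φ`) `unitsMap_mem_normOneUnits_iff`, `coe_quotConj_unitsMap` ∕ `quotConj_unitsMap` (`(Φ a)/σ′(Φ a) = Φ(a/σ(a))`),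
  `halfModulusChar_unitsMap` (**`‖Φ u‖_{R′}^{1/2} = ‖u‖_R^{1/2}`**, the module is a topological invariant — ★ `distribHaarChar_eq_of_continuousAddEquiv`),
  `generalLinearGroup_map_symm_map`, and on `U(σ, J)(R) → U(σ′, J′)(R′)` entrywise by `Φ`: membership in `B`, `T`, `N` (`mem_borelU_iff_of_coe_eq`,
  `mem_torusU_of_coe_eq`, `mem_torusU_iff_of_coe_eq`, `mem_unipotentU_iff_of_coe_eq`), `torusEntry_eq_unitsMap`, `coe_torusDetNormOne_eq_unitsMap`,
  and the LABEL CHARACTER **`torusCharPair_transport`**: `χ^{ξ′}(t′) = χ^{ξ}(t)` whenever `t′ = Φ·t` entrywise.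
* §2 (CM data) `antidiagOne_local_map` ∕ `cmLocalForm_map` (**`Φ(Φ_N ⊗ 1) = Φ_N ⊗ 1`**: the `hΦH` of ★ `exists_cmDatum_local_equiv` is automatic for the split forms),
  hence `exists_local_equiv` (`e_N : U(Φ_N)(L⁺_v) ≃ₜ* U(Φ_N)(L′⁺_{v′})` for every `N`; `N = 3` is `Gqs`, `qsForm` reducible), `exists_endo_equiv` (`e₂, e₁, e_H = e₂ × e₁`),
  `exists_torus_equiv` (`e₂` restricts to the diagonal tori); `coe_localDet_eq_unitsMap` ∕ `localDet_eq_unitsMap` (**`det(Φ·g) = Φ(det g)`**),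
  `comp_localDet_transport` (the `χ₁ = ψ_v ∘ det` slot), `torusCharPair_xi_transport` (the `χ₂` slot at the UDefs bytes).
The local character `ξ_v = ξ.xiLocalChar v` and the distribution `charDist (ξ.xiLocalChar v)` are transported in the sequel `Theorems/R90S10XiLocalCharTransport.lean`.
No statement of any socket is restated here; nothing here closes a socket by itself.

HONEST LABEL: transport-of-structure bookkeeping, no print input [Rogawski1990 §14.2 p. 232 «`G′_v` is isomorphic to `G_v`»]; HC_CM is proved only modulo the 7
printed citations (2 remaining named inputs: hLiu418 = stmt-HodgeConjecture-24832, h413 = stmt-HodgeConjecture-24833) until rung 0 closes; count-neutral helper.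

## References
* [Rogawski1990] J. D. Rogawski, *Automorphic Representations of Unitary Groups in Three Variables*, Ann. of Math. Stud. 123 (1990), §1.10 p. 9 (`B = MN`), §12.1 pp. 171–172
  (`χ = (χ₁, χ₂)`), §12.2 pp. 173–174 (`‖·‖^{1/2}`, `χ_ξ`), §13.1 Prop. 13.1.4 p. 199 (`ξ(f^H)`), §13.3 p. 202 (`ξ(h) = η(det₀ h) ψ(det h)`), §13.8 p. 217, §14.2 p. 232.
* [PlatonovRapinchuk1994] V. Platonov, A. Rapinchuk, *Algebraic Groups and Number Theory* (1994), §2.3 (equivalent forms), §5.1 (`G(K ⊗ K_v)`).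
* [WeilBNT1967] A. Weil, *Basic Number Theory* (1967), Ch. I §2 (the module of an automorphism is a topological invariant).
-/

set_option autoImplicit false
-- the mandated namespace repeats the single-problem summit's segment (`HodgeConjecture.HodgeConjecture`)
set_option linter.dupNamespace false

noncomputable section

open MeasureTheory Topology IsDedekindDomain NumberField Matrix
open Literature.NumberTheory Literature.NumberTheory.Automorphic Literature.NumberTheory.Automorphic.UnitaryGroup
open Literature.NumberTheory.Rogawski1990 Literature.NumberTheory.GaloisRepresentations
open scoped MatrixGroups NNReal

namespace Summit.HodgeConjecture.HodgeConjecture.R90.S10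

/-! ## §1 Generic: units, `E¹`, `a/ā`, `‖·‖^{1/2}`, and `B, T, N ≤ U(σ, J)(R)` along a ring isomorphism `Φ : R ≃+* R′` with `Φ ∘ σ = σ′ ∘ Φ` -/

section Generic

variable {R R' : Type*} [CommRing R] [CommRing R'] (Φ : R ≃+* R') {σ : R →+* R} {σ' : R' →+* R'}

/-- `Φ(σ u) = σ′(Φ u)` on units. [cite: PlatonovRapinchuk1994, §2.3] -/
theorem unitsMap_unitsMap_conj (hΦσ : ∀ x, Φ (σ x) = σ' (Φ x)) (u : Rˣ) :
    Units.map (Φ : R →+* R').toMonoidHom (Units.map (σ : R →* R) u) =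
      Units.map (σ' : R' →* R') (Units.map (Φ : R →+* R').toMonoidHom u) :=
  Units.ext (hΦσ u)

/-- **`Φ` carries `E¹ = {σ(x) x = 1}` onto `E′¹`**: `Φ u ∈ normOneUnits σ′ ↔ u ∈ normOneUnits σ`. [cite: Rogawski1990, §1.10 p. 9] [cite: PlatonovRapinchuk1994, §2.3] -/
theorem unitsMap_mem_normOneUnits_iff (hΦσ : ∀ x, Φ (σ x) = σ' (Φ x)) (u : Rˣ) :
    Units.map (Φ : R →+* R').toMonoidHom u ∈ normOneUnits σ' ↔ u ∈ normOneUnits σ := by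
  rw [mem_normOneUnits_iff, mem_normOneUnits_iff]
  change σ' (Φ (u : R)) * Φ (u : R) = 1 ↔ σ (u : R) * (u : R) = 1
  rw [← hΦσ, ← map_mul]
  exact EmbeddingLike.map_eq_one_iff

/-- **`(Φ a)/σ′(Φ a) = Φ(a/σ(a))`** in `R′ˣ` (★ `coe_quotConj`). [cite: Rogawski1990, §12.1 p. 172] -/
theorem coe_quotConj_unitsMap (hΦσ : ∀ x, Φ (σ x) = σ' (Φ x)) (hσ : ∀ x : R, σ (σ x) = x) (hσ' : ∀ x : R', σ' (σ' x) = x) (u : Rˣ) :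
    ((quotConj σ' hσ' (Units.map (Φ : R →+* R').toMonoidHom u) : ↥(normOneUnits σ')) : R'ˣ) =
      Units.map (Φ : R →+* R').toMonoidHom ((quotConj σ hσ u : ↥(normOneUnits σ)) : Rˣ) := by
  rw [coe_quotConj, coe_quotConj, map_mul, map_inv, unitsMap_unitsMap_conj Φ hΦσ]

/-- `quotConj σ′ (Φ a) = ⟨Φ (quotConj σ a), _⟩` as elements of `E′¹`. [cite: Rogawski1990, §12.1 p. 172] -/
theorem quotConj_unitsMap (hΦσ : ∀ x, Φ (σ x) = σ' (Φ x)) (hσ : ∀ x : R, σ (σ x) = x) (hσ' : ∀ x : R', σ' (σ' x) = x) (u : Rˣ) :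
    quotConj σ' hσ' (Units.map (Φ : R →+* R').toMonoidHom u) =
      ⟨Units.map (Φ : R →+* R').toMonoidHom ((quotConj σ hσ u : ↥(normOneUnits σ)) : Rˣ),
        (unitsMap_mem_normOneUnits_iff Φ hΦσ _).2 (quotConj σ hσ u).2⟩ :=
  Subtype.ext (coe_quotConj_unitsMap Φ hΦσ hσ hσ' u)

/-- **`‖Φ u‖_{R′}^{1/2} = ‖u‖_R^{1/2}`** for a bicontinuous ring isomorphism `Φ`: the module `‖·‖ = distribHaarChar` is a topological invariant (★
`distribHaarChar_eq_of_continuousAddEquiv` along the additive homeomorphism `Φ`, which intertwines `u • ·` with `Φ u • ·`). [cite: WeilBNT1967, Ch. I §2]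
[cite: Rogawski1990, §12.2 p. 173] -/
theorem halfModulusChar_unitsMap [TopologicalSpace R] [IsTopologicalRing R] [LocallyCompactSpace R]
    [TopologicalSpace R'] [IsTopologicalRing R'] [LocallyCompactSpace R'] (hc : Continuous Φ) (hc' : Continuous Φ.symm) (u : Rˣ) :
    halfModulusChar R' (Units.map (Φ : R →+* R').toMonoidHom u) = halfModulusChar R u := by
  have h : unitModulusChar R' (Units.map (Φ : R →+* R').toMonoidHom u) = unitModulusChar R u := by
    unfold unitModulusChar
    let e : R ≃ₜ+ R' := { Φ.toAddEquiv with continuous_toFun := hc, continuous_invFun := hc' }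
    refine (Literature.NumberTheory.Automorphic.distribHaarChar_eq_of_continuousAddEquiv e u
      (Units.map (Φ : R →+* R').toMonoidHom u) fun a => ?_).symm
    change Φ ((u : R) • a) = ((Units.map (Φ : R →+* R').toMonoidHom u : R'ˣ) : R') • Φ a
    rw [smul_eq_mul, smul_eq_mul, map_mul, Units.coe_map]
    rfl
  refine Units.ext ?_
  rw [coe_halfModulusChar_apply, coe_halfModulusChar_apply, h]

variable {N : ℕ}

/-- `GL_N(Φ⁻¹) (GL_N(Φ) g) = g`. [cite: PlatonovRapinchuk1994, §2.3] -/
theorem generalLinearGroup_map_symm_map (g : GL (Fin N) R) :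
    Matrix.GeneralLinearGroup.map (Φ.symm : R' →+* R) (Matrix.GeneralLinearGroup.map (Φ : R →+* R') g) = g :=
  Matrix.GeneralLinearGroup.ext fun i j => by
    simp only [Matrix.GeneralLinearGroup.map_apply, RingHom.coe_coe, RingEquiv.symm_apply_apply]

/-- `det (GL_N(Φ) g) = Φ (det g)` in `R′ˣ` (Mathlib `Matrix.GeneralLinearGroup.map_det`, at the currency's `.toMonoidHom` spelling). [cite: PlatonovRapinchuk1994, §2.3] -/
theorem det_generalLinearGroup_map (g : GL (Fin N) R) :
    Matrix.GeneralLinearGroup.det (Matrix.GeneralLinearGroup.map (Φ : R →+* R') g) =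
      Units.map (Φ : R →+* R').toMonoidHom (Matrix.GeneralLinearGroup.det g) :=
  Matrix.GeneralLinearGroup.map_det _ g

variable {J : Matrix (Fin N) (Fin N) R} {J' : Matrix (Fin N) (Fin N) R'}

/-- Entries: if `g′ = GL_N(Φ) g` then `g′_{ij} = Φ(g_{ij})`. [cite: PlatonovRapinchuk1994, §2.3] -/
theorem coe_apply_of_coe_eq (g : ↥(unitaryGroupOfForm σ J)) (g' : ↥(unitaryGroupOfForm σ' J'))
    (hg : ((g' : GL (Fin N) R') : GL (Fin N) R') = Matrix.GeneralLinearGroup.map (Φ : R →+* R') (g : GL (Fin N) R)) (i j : Fin N) :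
    ((g' : GL (Fin N) R') : Matrix (Fin N) (Fin N) R') i j = Φ (((g : GL (Fin N) R) : Matrix (Fin N) (Fin N) R) i j) := by
  rw [hg]
  rfl

/-- **`B ↦ B′`**: for `g′ = GL_N(Φ) g`, `g′` is upper triangular iff `g` is. [cite: Rogawski1990, §1.10 p. 9] -/
theorem mem_borelU_iff_of_coe_eq (g : ↥(unitaryGroupOfForm σ J)) (g' : ↥(unitaryGroupOfForm σ' J'))
    (hg : ((g' : GL (Fin N) R') : GL (Fin N) R') = Matrix.GeneralLinearGroup.map (Φ : R →+* R') (g : GL (Fin N) R)) :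
    g' ∈ borelU σ' J' ↔ g ∈ borelU σ J := by
  rw [mem_borelU_iff, mem_borelU_iff]
  refine ⟨fun h i j hij => ?_, fun h i j hij => ?_⟩
  · have h1 := h hij
    rw [coe_apply_of_coe_eq Φ g g' hg] at h1
    exact (EmbeddingLike.map_eq_zero_iff (f := Φ)).1 h1
  · rw [coe_apply_of_coe_eq Φ g g' hg, h hij, map_zero]

/-- **`N ↦ N′`**: for `g′ = GL_N(Φ) g`, `g′` is upper unitriangular iff `g` is. [cite: Rogawski1990, §1.10 p. 9] -/
theorem mem_unipotentU_iff_of_coe_eq (g : ↥(unitaryGroupOfForm σ J)) (g' : ↥(unitaryGroupOfForm σ' J'))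
    (hg : ((g' : GL (Fin N) R') : GL (Fin N) R') = Matrix.GeneralLinearGroup.map (Φ : R →+* R') (g : GL (Fin N) R)) :
    g' ∈ unipotentU σ' J' ↔ g ∈ unipotentU σ J := by
  rw [mem_unipotentU_iff, mem_unipotentU_iff, ← mem_borelU_iff, ← mem_borelU_iff, mem_borelU_iff_of_coe_eq Φ g g' hg]
  refine and_congr Iff.rfl ⟨fun h i => ?_, fun h i => ?_⟩
  · have h1 := h i
    rw [coe_apply_of_coe_eq Φ g g' hg] at h1
    exact (EmbeddingLike.map_eq_one_iff (f := Φ)).1 h1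
  · rw [coe_apply_of_coe_eq Φ g g' hg, h i, map_one]

/-- **`T → T′`**: for `g′ = GL_N(Φ) g`, if `g = diag(d)` then `g′ = diag(Φ ∘ d)`. [cite: Rogawski1990, §1.10 p. 9] -/
theorem mem_torusU_of_coe_eq (g : ↥(unitaryGroupOfForm σ J)) (g' : ↥(unitaryGroupOfForm σ' J'))
    (hg : ((g' : GL (Fin N) R') : GL (Fin N) R') = Matrix.GeneralLinearGroup.map (Φ : R →+* R') (g : GL (Fin N) R))
    (h : g ∈ torusU σ J) : g' ∈ torusU σ' J' := by
  obtain ⟨d, hd⟩ := (mem_torusU_iff g).1 h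
  have hdm : ((g : GL (Fin N) R) : Matrix (Fin N) (Fin N) R) = Matrix.diagonal fun k => (d k : R) := by
    rw [← coe_glDiagonal N R d, hd]
  refine (mem_torusU_iff g').2 ⟨fun k => Units.map (Φ : R →+* R').toMonoidHom (d k), Matrix.GeneralLinearGroup.ext fun i j => ?_⟩
  rw [coe_glDiagonal, coe_apply_of_coe_eq Φ g g' hg, hdm, Matrix.diagonal_apply, Matrix.diagonal_apply]
  split_ifs with hij
  · rfl
  · rw [map_zero]

/-- **`T ↦ T′`**: for `g′ = GL_N(Φ) g`, `g′` is diagonal iff `g` is (the converse through `Φ⁻¹`). [cite: Rogawski1990, §1.10 p. 9] -/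
theorem mem_torusU_iff_of_coe_eq (g : ↥(unitaryGroupOfForm σ J)) (g' : ↥(unitaryGroupOfForm σ' J'))
    (hg : ((g' : GL (Fin N) R') : GL (Fin N) R') = Matrix.GeneralLinearGroup.map (Φ : R →+* R') (g : GL (Fin N) R)) :
    g' ∈ torusU σ' J' ↔ g ∈ torusU σ J := by
  refine ⟨fun h => mem_torusU_of_coe_eq Φ.symm g' g ?_ h, mem_torusU_of_coe_eq Φ g g' hg⟩
  rw [hg, generalLinearGroup_map_symm_map]

/-- **The torus coordinates transport**: `(t′)_{ii} = Φ(t_{ii})` for `t′ = GL_N(Φ) t` (★ `coe_torusEntry`). [cite: Rogawski1990, §1.10 p. 9] -/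
theorem torusEntry_eq_unitsMap (t : ↥(torusU σ J)) (t' : ↥(torusU σ' J'))
    (ht : (((t' : ↥(unitaryGroupOfForm σ' J')) : GL (Fin N) R') : GL (Fin N) R') =
      Matrix.GeneralLinearGroup.map (Φ : R →+* R') ((t : ↥(unitaryGroupOfForm σ J)) : GL (Fin N) R))
    (i : Fin N) :
    torusEntry σ' J' i t' = Units.map (Φ : R →+* R').toMonoidHom (torusEntry σ J i t) := by
  refine Units.ext ?_
  rw [coe_torusEntry, Units.coe_map, coe_torusEntry, coe_apply_of_coe_eq Φ _ _ ht]
  rfl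

/-- **The torus determinant transports**: `det t′ = Φ(det t)` in `R′ˣ` for `t′ = GL_N(Φ) t` (★ `coe_torusDetNormOne`, `coe_torusDet`, `RingHom.map_det`).
[cite: Rogawski1990, §12.1 p. 171] -/
theorem coe_torusDetNormOne_eq_unitsMap (hJ : J = (StdForm.antidiagonal N).over R) (hJ' : J' = (StdForm.antidiagonal N).over R')
    (t : ↥(torusU σ J)) (t' : ↥(torusU σ' J'))
    (ht : (((t' : ↥(unitaryGroupOfForm σ' J')) : GL (Fin N) R') : GL (Fin N) R') =
      Matrix.GeneralLinearGroup.map (Φ : R →+* R') ((t : ↥(unitaryGroupOfForm σ J)) : GL (Fin N) R)) :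
    ((torusDetNormOne σ' J' hJ' t' : ↥(normOneUnits σ')) : R'ˣ) =
      Units.map (Φ : R →+* R').toMonoidHom ((torusDetNormOne σ J hJ t : ↥(normOneUnits σ)) : Rˣ) := by
  rw [coe_torusDetNormOne, coe_torusDetNormOne]
  refine Units.ext ?_
  rw [coe_torusDet, Units.coe_map, coe_torusDet, ht]
  exact (RingHom.map_det (Φ : R →+* R') _).symm

/-- `torusDetNormOne σ′ t′ = ⟨Φ (torusDetNormOne σ t), _⟩` in `E′¹`. [cite: Rogawski1990, §12.1 p. 171] -/
theorem torusDetNormOne_eq_unitsMap (hΦσ : ∀ x, Φ (σ x) = σ' (Φ x))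
    (hJ : J = (StdForm.antidiagonal N).over R) (hJ' : J' = (StdForm.antidiagonal N).over R')
    (t : ↥(torusU σ J)) (t' : ↥(torusU σ' J'))
    (ht : (((t' : ↥(unitaryGroupOfForm σ' J')) : GL (Fin N) R') : GL (Fin N) R') =
      Matrix.GeneralLinearGroup.map (Φ : R →+* R') ((t : ↥(unitaryGroupOfForm σ J)) : GL (Fin N) R)) :
    torusDetNormOne σ' J' hJ' t' =
      ⟨Units.map (Φ : R →+* R').toMonoidHom ((torusDetNormOne σ J hJ t : ↥(normOneUnits σ)) : Rˣ),
        (unitsMap_mem_normOneUnits_iff Φ hΦσ _).2 (torusDetNormOne σ J hJ t).2⟩ :=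
  Subtype.ext (coe_torusDetNormOne_eq_unitsMap Φ hJ hJ' t t' ht)

/-- **THE LABEL CHARACTER TRANSPORTS** (`χ₂` slot of ★ `HLengthTwoLabels`, and ★ `cmXiTorusChar`): for characters `η, ψ` of `E¹` and `η′, ψ′` of `E′¹` with
`η′(Φ t) = η(t)`, `ψ′(Φ t) = ψ(t)` (the (U2) binders `hΦη hΦψ`), and torus elements `t′ = GL_N(Φ) t`,
`(η′ ∘ quotConj · ‖·‖^{1/2}, ψ′)(t′) = (η ∘ quotConj · ‖·‖^{1/2}, ψ)(t)` — `χ(d) = χ₁(d_i) χ₂(det d)` (★ `torusCharPair_apply`) with every factor transported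
(`torusEntry_eq_unitsMap`, `quotConj_unitsMap`, `halfModulusChar_unitsMap`, `torusDetNormOne_eq_unitsMap`). [cite: Rogawski1990, §12.1 p. 171; §12.2 p. 174] [cite: WeilBNT1967, Ch. I §2] -/
theorem torusCharPair_transport [TopologicalSpace R] [IsTopologicalRing R] [LocallyCompactSpace R]
    [TopologicalSpace R'] [IsTopologicalRing R'] [LocallyCompactSpace R'] (hc : Continuous Φ) (hc' : Continuous Φ.symm)
    (hΦσ : ∀ x, Φ (σ x) = σ' (Φ x)) (hσ : ∀ x : R, σ (σ x) = x) (hσ' : ∀ x : R', σ' (σ' x) = x)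
    (hJ : J = (StdForm.antidiagonal N).over R) (hJ' : J' = (StdForm.antidiagonal N).over R') (i : Fin N)
    (η : ↥(normOneUnits σ) →* ℂˣ) (η' : ↥(normOneUnits σ') →* ℂˣ)
    (hη : ∀ (t : ↥(normOneUnits σ)) (ht : Units.map (Φ : R →+* R').toMonoidHom t.1 ∈ normOneUnits σ'),
      η' ⟨Units.map (Φ : R →+* R').toMonoidHom t.1, ht⟩ = η t)
    (ψ : ↥(normOneUnits σ) →* ℂˣ) (ψ' : ↥(normOneUnits σ') →* ℂˣ)
    (hψ : ∀ (t : ↥(normOneUnits σ)) (ht : Units.map (Φ : R →+* R').toMonoidHom t.1 ∈ normOneUnits σ'),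
      ψ' ⟨Units.map (Φ : R →+* R').toMonoidHom t.1, ht⟩ = ψ t)
    (t : ↥(torusU σ J)) (t' : ↥(torusU σ' J'))
    (ht : (((t' : ↥(unitaryGroupOfForm σ' J')) : GL (Fin N) R') : GL (Fin N) R') =
      Matrix.GeneralLinearGroup.map (Φ : R →+* R') ((t : ↥(unitaryGroupOfForm σ J)) : GL (Fin N) R)) :
    torusCharPair σ' J' hJ' i (η'.comp (quotConj σ' hσ') * halfModulusChar R') ψ' t' =
      torusCharPair σ J hJ i (η.comp (quotConj σ hσ) * halfModulusChar R) ψ t := by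
  rw [torusCharPair_apply, torusCharPair_apply, MonoidHom.mul_apply, MonoidHom.mul_apply, MonoidHom.comp_apply, MonoidHom.comp_apply,
    torusEntry_eq_unitsMap Φ t t' ht i, quotConj_unitsMap Φ hΦσ hσ hσ', hη, halfModulusChar_unitsMap Φ hc hc',
    torusDetNormOne_eq_unitsMap Φ hΦσ hJ hJ' t t' ht, hψ]

end Generic

/-! ## §2 The CM instance: `R_v = L ⊗ L⁺_v`, `σ = c ⊗ 1`, the split forms `Φ_N`, `det`, `ξ_v` and `χ_ξ(f^H)` -/

section CM

variable (L : Type) [Field L] [NumberField L] [IsCMField L] (v : HeightOneSpectrum (𝓞 ↥(maximalRealSubfield L)))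
  (L' : Type) [Field L'] [NumberField L'] [IsCMField L'] (v' : HeightOneSpectrum (𝓞 ↥(maximalRealSubfield L')))
  (Φ : UnitaryGroup.LocalRing L v ≃+* UnitaryGroup.LocalRing L' v')

omit [IsCMField L] [IsCMField L'] in
/-- **`Φ(Φ_N ⊗ 1) = Φ_N ⊗ 1`**: the split form has entries `0, 1`, so EVERY ring isomorphism of local rings carries `Φ_N ⊗_L (L ⊗ L⁺_v)` to `Φ_N ⊗_{L′} (L′ ⊗ L′⁺_{v′})` —
the `hΦH` hypothesis of ★ `exists_cmDatum_local_equiv` for `H = H′ = Φ_N` (`N = 3`: ★ `qsForm`, reducible). [cite: Rogawski1990, §14.2 p. 232] [cite: PlatonovRapinchuk1994, §2.3] -/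
theorem antidiagOne_local_map (N : ℕ) :
    ((Matrix.of fun i j : Fin N => if i.val + j.val + 1 = N then (1 : L) else 0).map (algebraMap L (UnitaryGroup.LocalRing L v))).map Φ =
      (Matrix.of fun i j : Fin N => if i.val + j.val + 1 = N then (1 : L') else 0).map (algebraMap L' (UnitaryGroup.LocalRing L' v')) := by
  ext i j
  simp only [Matrix.map_apply, Matrix.of_apply]
  split_ifs <;> simp

omit [IsCMField L] [IsCMField L'] in
/-- **`Φ(cmLocalForm L N v) = cmLocalForm L′ N v′`** (both are `(StdForm.antidiagonal N).over _`, ★ `cmLocalForm_eq_over`, `StdForm.over_map`). [cite: Rogawski1990, §14.2 p. 232] -/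
theorem cmLocalForm_map (N : ℕ) : (cmLocalForm L N v).map Φ = cmLocalForm L' N v' := by
  rw [cmLocalForm_eq_over, cmLocalForm_eq_over]
  exact (StdForm.antidiagonal N).over_map (Φ : UnitaryGroup.LocalRing L v →+* UnitaryGroup.LocalRing L' v')

/-- **`e_N : U(Φ_N)(L⁺_v) ≃ₜ* U(Φ_N)(L′⁺_{v′})`, `g ↦ Φ(g)` entrywise**, for every `N`, along S3's datum `(Φ, hc, hc′, hΦσ)` (★ `exists_cmDatum_local_equiv` with the
automatic `hΦH` = `antidiagOne_local_map`); `N = 3` is the currency's `e₃` on `Gqs` (★ `qsForm` reducible), `N = 2, 1` the factors of `e_H`.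
[cite: Rogawski1990, §14.2 p. 232] [cite: PlatonovRapinchuk1994, §5.1] -/
theorem exists_local_equiv (hc : Continuous Φ) (hc' : Continuous Φ.symm)
    (hΦσ : ∀ x, Φ ((conjLocal L (IsCMField.complexConj L) v) x) = (conjLocal L' (IsCMField.complexConj L') v') (Φ x)) (N : ℕ) :
    ∃ e : (UnitaryGroup.cmDatum L N (Matrix.of fun i j : Fin N => if i.val + j.val + 1 = N then (1 : L) else 0)).Local v ≃ₜ*
        (UnitaryGroup.cmDatum L' N (Matrix.of fun i j : Fin N => if i.val + j.val + 1 = N then (1 : L') else 0)).Local v',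
      ∀ g, ((e g).val : GL (Fin N) (UnitaryGroup.LocalRing L' v')) =
        Matrix.GeneralLinearGroup.map (Φ : UnitaryGroup.LocalRing L v →+* UnitaryGroup.LocalRing L' v') (g.val : GL (Fin N) (UnitaryGroup.LocalRing L v)) :=
  Summit.HodgeConjecture.HodgeConjecture.Cruxes.H413.K2E1GroundFieldChangeLocalIso.exists_cmDatum_local_equiv L L' N _ _ v v' Φ hc hc' hΦσ
    (antidiagOne_local_map L v L' v' Φ N)

/-- **`(e₂, e₁, e_H = e₂ × e₁)`**: the currency's endoscopic-group isomorphisms along `(Φ, hc, hc′, hΦσ)`, with S3's bytes `he₂ he₁ heH`.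
[cite: Rogawski1990, §14.2 p. 232; §4.8 p. 53] [cite: PlatonovRapinchuk1994, §5.1] -/
theorem exists_endo_equiv (hc : Continuous Φ) (hc' : Continuous Φ.symm)
    (hΦσ : ∀ x, Φ ((conjLocal L (IsCMField.complexConj L) v) x) = (conjLocal L' (IsCMField.complexConj L') v') (Φ x)) :
    ∃ (e₂ : (UnitaryGroup.cmDatum L 2 (Matrix.of fun i j : Fin 2 => if i.val + j.val + 1 = 2 then (1 : L) else 0)).Local v ≃ₜ*
        (UnitaryGroup.cmDatum L' 2 (Matrix.of fun i j : Fin 2 => if i.val + j.val + 1 = 2 then (1 : L') else 0)).Local v')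
      (e₁ : (UnitaryGroup.cmDatum L 1 (Matrix.of fun i j : Fin 1 => if i.val + j.val + 1 = 1 then (1 : L) else 0)).Local v ≃ₜ*
        (UnitaryGroup.cmDatum L' 1 (Matrix.of fun i j : Fin 1 => if i.val + j.val + 1 = 1 then (1 : L') else 0)).Local v')
      (eH : ((UnitaryGroup.cmDatum L 2 (Matrix.of fun i j : Fin 2 => if i.val + j.val + 1 = 2 then (1 : L) else 0)).Local v ×
          (UnitaryGroup.cmDatum L 1 (Matrix.of fun i j : Fin 1 => if i.val + j.val + 1 = 1 then (1 : L) else 0)).Local v) ≃ₜ*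
        ((UnitaryGroup.cmDatum L' 2 (Matrix.of fun i j : Fin 2 => if i.val + j.val + 1 = 2 then (1 : L') else 0)).Local v' ×
          (UnitaryGroup.cmDatum L' 1 (Matrix.of fun i j : Fin 1 => if i.val + j.val + 1 = 1 then (1 : L') else 0)).Local v')),
      (∀ g, ((e₂ g).val : GL (Fin 2) (UnitaryGroup.LocalRing L' v')) =
        Matrix.GeneralLinearGroup.map (Φ : UnitaryGroup.LocalRing L v →+* UnitaryGroup.LocalRing L' v') (g.val : GL (Fin 2) (UnitaryGroup.LocalRing L v))) ∧
      (∀ g, ((e₁ g).val : GL (Fin 1) (UnitaryGroup.LocalRing L' v')) =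
        Matrix.GeneralLinearGroup.map (Φ : UnitaryGroup.LocalRing L v →+* UnitaryGroup.LocalRing L' v') (g.val : GL (Fin 1) (UnitaryGroup.LocalRing L v))) ∧
      (∀ h, eH h = (e₂ h.1, e₁ h.2)) := by
  obtain ⟨e₂, he₂⟩ := exists_local_equiv L v L' v' Φ hc hc' hΦσ 2
  obtain ⟨e₁, he₁⟩ := exists_local_equiv L v L' v' Φ hc hc' hΦσ 1
  exact ⟨e₂, e₁,
    { e₂.toMulEquiv.prodCongr e₁.toMulEquiv with
      continuous_toFun := (e₂.continuous.comp continuous_fst).prodMk (e₁.continuous.comp continuous_snd)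
      continuous_invFun := (e₂.symm.continuous.comp continuous_fst).prodMk (e₁.symm.continuous.comp continuous_snd) },
    he₂, he₁, fun _ => rfl⟩

/-- **`e₂` restricts to the diagonal tori `T(L⁺_v) ≃ₜ* T(L′⁺_{v′})`** (`mem_torusU_iff_of_coe_eq` + ★ `ContinuousMulEquiv.restrictSubgroup`), with the entrywise formula.
[cite: Rogawski1990, §1.10 p. 9; §14.2 p. 232] -/
theorem exists_torus_equiv {N : ℕ}
    (e : (UnitaryGroup.cmDatum L N (Matrix.of fun i j : Fin N => if i.val + j.val + 1 = N then (1 : L) else 0)).Local v ≃ₜ*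
      (UnitaryGroup.cmDatum L' N (Matrix.of fun i j : Fin N => if i.val + j.val + 1 = N then (1 : L') else 0)).Local v')
    (he : ∀ g, ((e g).val : GL (Fin N) (UnitaryGroup.LocalRing L' v')) =
      Matrix.GeneralLinearGroup.map (Φ : UnitaryGroup.LocalRing L v →+* UnitaryGroup.LocalRing L' v') (g.val : GL (Fin N) (UnitaryGroup.LocalRing L v))) :
    ∃ eT : ↥(torusU (conjLocal L (IsCMField.complexConj L) v) (cmLocalForm L N v)) ≃ₜ*
        ↥(torusU (conjLocal L' (IsCMField.complexConj L') v') (cmLocalForm L' N v')),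
      ∀ t, ((eT t : ↥(torusU (conjLocal L' (IsCMField.complexConj L') v') (cmLocalForm L' N v'))) :
          ↥(unitaryGroupOfForm (conjLocal L' (IsCMField.complexConj L') v') (cmLocalForm L' N v'))) =
        e (t : ↥(unitaryGroupOfForm (conjLocal L (IsCMField.complexConj L) v) (cmLocalForm L N v))) :=
  ⟨ContinuousMulEquiv.restrictSubgroup e _ _ fun g => (mem_torusU_iff_of_coe_eq Φ g (e g) (he g)).symm, fun _ => rfl⟩

/-- **`det(Φ·g) = Φ(det g)`** in `(L′ ⊗ L′⁺_{v′})ˣ` for the local determinant ★ `localDet` of `U(Φ_N)` (★ `coe_localDet`, Mathlib `Matrix.GeneralLinearGroup.map_det`).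
[cite: Rogawski1990, §3.13; §14.2 p. 232] -/
theorem coe_localDet_eq_unitsMap {N : ℕ}
    (g : (UnitaryGroup.cmDatum L N (Matrix.of fun i j : Fin N => if i.val + j.val + 1 = N then (1 : L) else 0)).Local v)
    (g' : (UnitaryGroup.cmDatum L' N (Matrix.of fun i j : Fin N => if i.val + j.val + 1 = N then (1 : L') else 0)).Local v')
    (hg : (g'.val : GL (Fin N) (UnitaryGroup.LocalRing L' v')) =
      Matrix.GeneralLinearGroup.map (Φ : UnitaryGroup.LocalRing L v →+* UnitaryGroup.LocalRing L' v') (g.val : GL (Fin N) (UnitaryGroup.LocalRing L v))) :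
    ((localDet (IsCMField.complexConj L') v' (isUnit_antidiagOne_det L' N) g' : ↥(normOneUnits (conjLocal L' (IsCMField.complexConj L') v'))) :
        (UnitaryGroup.LocalRing L' v')ˣ) =
      Units.map (Φ : UnitaryGroup.LocalRing L v →+* UnitaryGroup.LocalRing L' v').toMonoidHom
        ((localDet (IsCMField.complexConj L) v (isUnit_antidiagOne_det L N) g : ↥(normOneUnits (conjLocal L (IsCMField.complexConj L) v))) :
          (UnitaryGroup.LocalRing L v)ˣ) := by
  rw [coe_localDet, coe_localDet]
  change Matrix.GeneralLinearGroup.det (g'.val : GL (Fin N) (UnitaryGroup.LocalRing L' v')) = _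
  rw [hg]
  exact det_generalLinearGroup_map Φ _

/-- `localDet (Φ·g) = ⟨Φ (localDet g), _⟩` in `E′¹_{v′}`. [cite: Rogawski1990, §3.13; §14.2 p. 232] -/
theorem localDet_eq_unitsMap {N : ℕ}
    (hΦσ : ∀ x, Φ ((conjLocal L (IsCMField.complexConj L) v) x) = (conjLocal L' (IsCMField.complexConj L') v') (Φ x))
    (g : (UnitaryGroup.cmDatum L N (Matrix.of fun i j : Fin N => if i.val + j.val + 1 = N then (1 : L) else 0)).Local v)
    (g' : (UnitaryGroup.cmDatum L' N (Matrix.of fun i j : Fin N => if i.val + j.val + 1 = N then (1 : L') else 0)).Local v')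
    (hg : (g'.val : GL (Fin N) (UnitaryGroup.LocalRing L' v')) =
      Matrix.GeneralLinearGroup.map (Φ : UnitaryGroup.LocalRing L v →+* UnitaryGroup.LocalRing L' v') (g.val : GL (Fin N) (UnitaryGroup.LocalRing L v))) :
    localDet (IsCMField.complexConj L') v' (isUnit_antidiagOne_det L' N) g' =
      ⟨Units.map (Φ : UnitaryGroup.LocalRing L v →+* UnitaryGroup.LocalRing L' v').toMonoidHom
          ((localDet (IsCMField.complexConj L) v (isUnit_antidiagOne_det L N) g : ↥(normOneUnits (conjLocal L (IsCMField.complexConj L) v))) :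
            (UnitaryGroup.LocalRing L v)ˣ),
        (unitsMap_mem_normOneUnits_iff Φ hΦσ _).2 (localDet (IsCMField.complexConj L) v (isUnit_antidiagOne_det L N) g).2⟩ :=
  Subtype.ext (coe_localDet_eq_unitsMap L v L' v' Φ g g' hg)

/-- **The `χ₁ = ψ_v ∘ det` slot transports**: for characters `ψ, ψ′` of `E¹_v, E′¹_{v′}` with `ψ′(Φ t) = ψ(t)` (the binder `hΦψ`) and `g′ = Φ·g`,
`(ψ′ ∘ det)(g′) = (ψ ∘ det)(g)`. [cite: Rogawski1990, §12.1 p. 171; §14.2 p. 232] -/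
theorem comp_localDet_transport {N : ℕ}
    (hΦσ : ∀ x, Φ ((conjLocal L (IsCMField.complexConj L) v) x) = (conjLocal L' (IsCMField.complexConj L') v') (Φ x))
    (ψ : ↥(normOneUnits (conjLocal L (IsCMField.complexConj L) v)) →* ℂˣ) (ψ' : ↥(normOneUnits (conjLocal L' (IsCMField.complexConj L') v')) →* ℂˣ)
    (hψ : ∀ (t : ↥(normOneUnits (conjLocal L (IsCMField.complexConj L) v)))
      (ht : Units.map (Φ : UnitaryGroup.LocalRing L v →+* UnitaryGroup.LocalRing L' v').toMonoidHom t.1 ∈ normOneUnits (conjLocal L' (IsCMField.complexConj L') v')),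
      ψ' ⟨Units.map (Φ : UnitaryGroup.LocalRing L v →+* UnitaryGroup.LocalRing L' v').toMonoidHom t.1, ht⟩ = ψ t)
    (g : (UnitaryGroup.cmDatum L N (Matrix.of fun i j : Fin N => if i.val + j.val + 1 = N then (1 : L) else 0)).Local v)
    (g' : (UnitaryGroup.cmDatum L' N (Matrix.of fun i j : Fin N => if i.val + j.val + 1 = N then (1 : L') else 0)).Local v')
    (hg : (g'.val : GL (Fin N) (UnitaryGroup.LocalRing L' v')) =
      Matrix.GeneralLinearGroup.map (Φ : UnitaryGroup.LocalRing L v →+* UnitaryGroup.LocalRing L' v') (g.val : GL (Fin N) (UnitaryGroup.LocalRing L v))) :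
    ψ'.comp (localDet (IsCMField.complexConj L') v' (isUnit_antidiagOne_det L' N)) g' =
      ψ.comp (localDet (IsCMField.complexConj L) v (isUnit_antidiagOne_det L N)) g := by
  rw [MonoidHom.comp_apply, MonoidHom.comp_apply, localDet_eq_unitsMap L v L' v' Φ hΦσ g g' hg, hψ]

/-- **The `χ₂` slot of ★ `HLengthTwoLabels` ∕ the character `χ_ξ` transports, AT THE (U2) BYTES**: for `ξ = (η, ψ)`, `ξ′ = (η′, ψ′)` with the UDefs binders `hΦη hΦψ`
(`η′_{v′}(Φ t) = η_v(t)`, `ψ′_{v′}(Φ t) = ψ_v(t)`), and torus elements `t′ = GL_N(Φ) t`,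
`torusCharPair (c′ ⊗ 1) (cmLocalForm L′ N v′) _ i ((η′_{v′} ∘ quotConj) · ‖·‖^{1/2}) ψ′_{v′} t′ = torusCharPair (c ⊗ 1) (cmLocalForm L N v) _ i ((η_v ∘ quotConj) · ‖·‖^{1/2}) ψ_v t`
(`torusCharPair_transport` at the CM data). [cite: Rogawski1990, §12.1 p. 171; §12.2 p. 174; §13.8 p. 217] [cite: WeilBNT1967, Ch. I §2] -/
theorem torusCharPair_xi_transport {N : ℕ} (hc : Continuous Φ) (hc' : Continuous Φ.symm)
    (hΦσ : ∀ x, Φ ((conjLocal L (IsCMField.complexConj L) v) x) = (conjLocal L' (IsCMField.complexConj L') v') (Φ x))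
    (ξ : OneDimAutRepH L) (ξ' : OneDimAutRepH L')
    (hΦη : ∀ (t : ↥(normOneUnits (conjLocal L (IsCMField.complexConj L) v)))
      (ht : Units.map (Φ : UnitaryGroup.LocalRing L v →+* UnitaryGroup.LocalRing L' v').toMonoidHom t.1 ∈ normOneUnits (conjLocal L' (IsCMField.complexConj L') v')),
      torusLocalComponent L' (IsCMField.complexConj L') v' ξ'.η ⟨Units.map (Φ : UnitaryGroup.LocalRing L v →+* UnitaryGroup.LocalRing L' v').toMonoidHom t.1, ht⟩ =
        torusLocalComponent L (IsCMField.complexConj L) v ξ.η t)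
    (hΦψ : ∀ (t : ↥(normOneUnits (conjLocal L (IsCMField.complexConj L) v)))
      (ht : Units.map (Φ : UnitaryGroup.LocalRing L v →+* UnitaryGroup.LocalRing L' v').toMonoidHom t.1 ∈ normOneUnits (conjLocal L' (IsCMField.complexConj L') v')),
      torusLocalComponent L' (IsCMField.complexConj L') v' ξ'.ψ ⟨Units.map (Φ : UnitaryGroup.LocalRing L v →+* UnitaryGroup.LocalRing L' v').toMonoidHom t.1, ht⟩ =
        torusLocalComponent L (IsCMField.complexConj L) v ξ.ψ t)
    (i : Fin N) (t : ↥(torusU (conjLocal L (IsCMField.complexConj L) v) (cmLocalForm L N v)))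
    (t' : ↥(torusU (conjLocal L' (IsCMField.complexConj L') v') (cmLocalForm L' N v')))
    (ht : (((t' : ↥(unitaryGroupOfForm (conjLocal L' (IsCMField.complexConj L') v') (cmLocalForm L' N v'))) : GL (Fin N) (UnitaryGroup.LocalRing L' v')) :
        GL (Fin N) (UnitaryGroup.LocalRing L' v')) =
      Matrix.GeneralLinearGroup.map (Φ : UnitaryGroup.LocalRing L v →+* UnitaryGroup.LocalRing L' v')
        ((t : ↥(unitaryGroupOfForm (conjLocal L (IsCMField.complexConj L) v) (cmLocalForm L N v))) : GL (Fin N) (UnitaryGroup.LocalRing L v))) :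
    torusCharPair (conjLocal L' (IsCMField.complexConj L') v') (cmLocalForm L' N v') (cmLocalForm_eq_over L' N v') i
        ((torusLocalComponent L' (IsCMField.complexConj L') v' ξ'.η).comp
            (quotConj (conjLocal L' (IsCMField.complexConj L') v') (conjLocal_conjLocal_cm L' v')) *
          halfModulusChar (UnitaryGroup.LocalRing L' v'))
        (torusLocalComponent L' (IsCMField.complexConj L') v' ξ'.ψ) t' =
      torusCharPair (conjLocal L (IsCMField.complexConj L) v) (cmLocalForm L N v) (cmLocalForm_eq_over L N v) i
        ((torusLocalComponent L (IsCMField.complexConj L) v ξ.η).comp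
            (quotConj (conjLocal L (IsCMField.complexConj L) v) (conjLocal_conjLocal_cm L v)) *
          halfModulusChar (UnitaryGroup.LocalRing L v))
        (torusLocalComponent L (IsCMField.complexConj L) v ξ.ψ) t :=
  torusCharPair_transport Φ hc hc' hΦσ (conjLocal_conjLocal_cm L v) (conjLocal_conjLocal_cm L' v') (cmLocalForm_eq_over L N v) (cmLocalForm_eq_over L' N v') i
    _ _ hΦη _ _ hΦψ t t' ht

end CM

end Summit.HodgeConjecture.HodgeConjecture.R90.S10

end
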